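import Mathlib
import Literature.Combinatorics.Optimization.SDPRelaxationsMaxCSP

/-!
# Sum-of-squares degree versus pseudo-densities: the cone duality (Lee–Raghavendra–Steurer 2015, §2), PROVED

Lee–Raghavendra–Steurer [LeeRaghavendraSteurer2015, §2 (p. 11 of arXiv:1411.6317)] record the
duality that drives every lower bound of the paper:

> "A degree-`d` pseudo-density is a mapping `D : {0,1}^m → ℝ` such that `E_x D(x) = 1` and
> `E_x D(x) g(x)² ≥ 0` for all functions `g : {0,1}^m → ℝ` with `deg(g) ≤ d/2`. … One has the
> following characterization:
> `deg_sos(f) = min { d ≥ 0 : E_x D(x) f(x) ≥ 0 for every degree-d pseudo-density D }`.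
> In other words, the sos degree of a function is larger than `d` if and only if there exists a
> degree-`d` pseudo-density `D` such that `E_x D(x) f(x) < 0`.  To verify this, note that if
> `deg_sos(f) > d`, then `f` is not in the closed, convex cone generated by the squares of polynomials
> of degree at most `d/2`. Now the required pseudo-density `D` corresponds exactly to (the normal
> vector of) a hyperplane separating `f` from this cone."

This file PROVES that statement over the tree's vocabulary (`HasSosCertificate`, `IsPseudoDensity`,
`HasDegreeLE`, `cubeExpect` of `PatternMatrixPsdRank.lean`; the easy direction
`IsPseudoDensity.cubeExpect_mul_nonneg` is already there):

* `not_hasSosCertificate_iff_exists_pseudoDensity` — `f` has no degree-`d` sos certificate on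
  `{0,1}^m` iff some degree-`d` pseudo-density `D` has `E_x D(x) f(x) < 0`;
* the form in which §6 consumes it (first sentence of the proof of Thm 6.4, p. 26: "Given that the
  degree-`d(n)` sos relaxation cannot achieve a `(c + ε, s)`-approximation for Max-Π_n, there exists
  an instance `ℑ` of Max-Π_n such that `opt(ℑ) ≤ s`, along with a degree-`d(n)` pseudo-density `D`
  such that `E_x D(x)(c − ℑ(x)) < −ε`") — `exists_pseudoDensity_of_not_achievesApprox`, over the
  Max-CSP vocabulary of `SDPRelaxationsMaxCSP.lean` (`AchievesApprox`, `degreeLE`, `CSPInstance`).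

The one non-formal word in the printed proof is "closed".  We prove closedness of the cone
`Σ_d = {Σ_i g_i² : deg g_i ≤ d/2}` as follows (a standard argument, not in the source): with
`b_1,…,b_N` a basis of the space `V` of functions of degree `≤ d/2` and `q(x) ∈ ℝ^N` the coordinates
of point evaluation, every element of `Σ_d` is `x ↦ q(x)ᵀ Q q(x)` with `Q = Σ_i λ_i λ_iᵀ ⪰ 0`, hence
(`Q = S²`, `S = Q^{1/2}`) a sum of exactly `N` squares `Σ_i ((S q(x))_i)²`; so `Σ_d` is the image of
`ℝ^{N×N}` under the continuous map `Ψ(B)(x) = Σ_i ((B q(x))_i)²`, and `Ψ` is proper on sublevel sets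
of `h ↦ Σ_x h(x)` because `a ↦ (x ↦ aᵀ q(x))` is injective, hence anti-Lipschitz
(`LinearMap.exists_antilipschitzWith`); a compact image is closed.  Separation is
`geometric_hahn_banach_closed_point`; the separating functional `ℓ` is `h ↦ −E_x D(x) h(x)` for
`D(x) = −2^m ℓ(e_x)`, and `D` is normalised to `E D = 1` after adding a small multiple of the uniform
density (`E D ≥ 0` because `1 = 1²` is a square of degree `0`).

No new definitions beyond the auxiliary `degreeLESubmodule` (the space `V` as a `Submodule`),
`evalCoords` (`q`), `sosGram` (`Ψ`); no named facts.
-/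

noncomputable section

open Finset Matrix
open scoped MatrixOrder

namespace Literature.Combinatorics.Optimization

variable {m : ℕ}

/-! ### The space of functions of degree `≤ k` and the cone of degree-`d` sums of squares -/

/-- The functions of (multilinear) degree at most `k` on `{0,1}^m`, as a subspace of all real
functions on the cube ("the linear subspace of polynomials of degree at most `d/2`"; as a set this
is `degreeLE m k`). [cite: LeeRaghavendraSteurer2015, §2 (p. 11)] -/
def degreeLESubmodule (m k : ℕ) : Submodule ℝ ((Fin m → Bool) → ℝ) where
  carrier := {g | HasDegreeLE k g}
  add_mem' := by
    rintro f g ⟨P, hP, hPf⟩ ⟨Q, hQ, hQg⟩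
    exact ⟨P + Q, (MvPolynomial.totalDegree_add P Q).trans (max_le hP hQ), fun x => by
      simp [hPf x, hQg x]⟩
  zero_mem' := ⟨0, by simp, fun x => by simp⟩
  smul_mem' := by
    rintro a f ⟨P, hP, hPf⟩
    refine ⟨MvPolynomial.C a * P, (MvPolynomial.totalDegree_mul _ _).trans ?_, fun x => by
      simp [hPf x]⟩
    rw [MvPolynomial.totalDegree_C, zero_add]
    exact hP

/-- Membership in `degreeLESubmodule` is `HasDegreeLE`. [cite: LeeRaghavendraSteurer2015, §2 (p. 11)] -/
@[simp] theorem mem_degreeLESubmodule {k : ℕ} {g : (Fin m → Bool) → ℝ} :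
    g ∈ degreeLESubmodule m k ↔ HasDegreeLE k g := Iff.rfl

/-- As a set, `degreeLESubmodule m k` is `degreeLE m k`. [cite: LeeRaghavendraSteurer2015, Thm 1.6 (p. 6)] -/
theorem coe_degreeLESubmodule (m k : ℕ) :
    (degreeLESubmodule m k : Set ((Fin m → Bool) → ℝ)) = degreeLE m k := rfl

/-- The dimension `N = dim V` of the space of functions of degree `≤ k` on `{0,1}^m`.
[cite: LeeRaghavendraSteurer2015, §2 (p. 11)] -/
abbrev degDim (m k : ℕ) : ℕ := Module.finrank ℝ (degreeLESubmodule m k)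

/-- Coordinates `q(x) ∈ ℝ^N` of point evaluation at `x`: `q(x)_l = b_l(x)` for the basis
`b = Module.finBasis` of the degree-`≤ k` space. [cite: LeeRaghavendraSteurer2015, §2 (p. 11)] -/
def evalCoords (m k : ℕ) (x : Fin m → Bool) : Fin (degDim m k) → ℝ :=
  fun l => ((Module.finBasis ℝ (degreeLESubmodule m k) l : degreeLESubmodule m k) :
    (Fin m → Bool) → ℝ) x

/-- A coordinate vector `a ∈ ℝ^N` defines the degree-`≤ k` function `x ↦ aᵀ q(x) = Σ_l a_l b_l(x)`.
[cite: LeeRaghavendraSteurer2015, §2 (p. 11)] -/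
theorem hasDegreeLE_dotProduct_evalCoords (k : ℕ) (a : Fin (degDim m k) → ℝ) :
    HasDegreeLE k (fun x => a ⬝ᵥ evalCoords m k x) := by
  set bV := Module.finBasis ℝ (degreeLESubmodule m k)
  have hmem := (∑ l, a l • bV l).2
  rw [mem_degreeLESubmodule] at hmem
  convert hmem using 1
  funext x
  simp only [Submodule.coe_sum, Submodule.coe_smul, Finset.sum_apply, Pi.smul_apply,
    smul_eq_mul, dotProduct, evalCoords, bV]

/-- Every degree-`≤ k` function is `x ↦ aᵀ q(x)` for its coordinate vector `a`.
[cite: LeeRaghavendraSteurer2015, §2 (p. 11)] -/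
theorem HasDegreeLE.exists_eq_dotProduct_evalCoords {k : ℕ} {g : (Fin m → Bool) → ℝ}
    (hg : HasDegreeLE k g) : ∃ a : Fin (degDim m k) → ℝ, ∀ x, g x = a ⬝ᵥ evalCoords m k x := by
  set bV := Module.finBasis ℝ (degreeLESubmodule m k)
  refine ⟨bV.repr ⟨g, hg⟩, fun x => ?_⟩
  have hsum := bV.sum_repr ⟨g, hg⟩
  have := congrArg (fun u : degreeLESubmodule m k => (u : (Fin m → Bool) → ℝ) x) hsum
  simp only [Submodule.coe_sum, Submodule.coe_smul, Finset.sum_apply, Pi.smul_apply,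
    smul_eq_mul] at this
  rw [← this, dotProduct]
  rfl

/-! #### Closure properties of `HasSosCertificate` (the cone `Σ_d`) -/

/-- A sum of squares indexed by any finite type is an sos certificate (reindexing).
[cite: LeeRaghavendraSteurer2015, §1 (sos certificates)] -/
theorem hasSosCertificate_of_fintype {ι : Type*} [Fintype ι] {d : ℕ} {f : (Fin m → Bool) → ℝ}
    (g : ι → (Fin m → Bool) → ℝ) (hg : ∀ i, HasDegreeLE (d / 2) (g i))
    (hf : ∀ x, f x = ∑ i, g i x ^ 2) : HasSosCertificate d f := by
  classical
  refine ⟨Fintype.card ι, fun j => g ((Fintype.equivFin ι).symm j), fun j => hg _, fun x => ?_⟩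
  rw [hf x]
  exact ((Fintype.equivFin ι).symm.sum_comp (fun i => g i x ^ 2)).symm

/-- `0 ∈ Σ_d`. [cite: LeeRaghavendraSteurer2015, §2 (p. 11: "convex cone")] -/
theorem HasSosCertificate.zero (d : ℕ) : HasSosCertificate d (fun _ : Fin m → Bool => (0 : ℝ)) :=
  ⟨0, fun i => i.elim0, fun i => i.elim0, fun x => by simp⟩

/-- `Σ_d` is closed under addition. [cite: LeeRaghavendraSteurer2015, §2 (p. 11: "convex cone")] -/
theorem HasSosCertificate.add {d : ℕ} {f g : (Fin m → Bool) → ℝ} (hf : HasSosCertificate d f)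
    (hg : HasSosCertificate d g) : HasSosCertificate d (fun x => f x + g x) := by
  obtain ⟨k, u, hu, hfx⟩ := hf
  obtain ⟨k', u', hu', hgx⟩ := hg
  refine hasSosCertificate_of_fintype (ι := Fin k ⊕ Fin k') (Sum.elim u u') (fun i => ?_)
    fun x => ?_
  · cases i
    · exact hu _
    · exact hu' _
  · rw [Fintype.sum_sum_type, hfx x, hgx x]
    simp

/-- `Σ_d` is closed under nonnegative scaling (`a Σ g_i² = Σ (√a g_i)²`).
[cite: LeeRaghavendraSteurer2015, §2 (p. 11: "convex cone")] -/
theorem HasSosCertificate.const_mul {d : ℕ} {f : (Fin m → Bool) → ℝ} (hf : HasSosCertificate d f)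
    {a : ℝ} (ha : 0 ≤ a) : HasSosCertificate d (fun x => a * f x) := by
  obtain ⟨k, u, hu, hfx⟩ := hf
  refine ⟨k, fun i x => Real.sqrt a * u i x, fun i => ?_, fun x => ?_⟩
  · exact (degreeLESubmodule m (d / 2)).smul_mem (Real.sqrt a) (hu i)
  · show a * f x = ∑ i, (Real.sqrt a * u i x) ^ 2
    rw [hfx x, mul_sum]
    refine sum_congr rfl fun i _ => ?_
    rw [mul_pow, Real.sq_sqrt ha]

/-- Squares of degree-`≤ d/2` functions are in `Σ_d`. [cite: LeeRaghavendraSteurer2015, §1 (sos certificates)] -/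
theorem HasDegreeLE.hasSosCertificate_sq {d : ℕ} {g : (Fin m → Bool) → ℝ}
    (hg : HasDegreeLE (d / 2) g) : HasSosCertificate d (fun x => g x ^ 2) :=
  hasSosCertificate_of_fintype (ι := Unit) (fun _ => g) (fun _ => hg) fun x => by simp

/-- `1 = 1²` is in `Σ_d`. [cite: LeeRaghavendraSteurer2015, §1 (sos certificates)] -/
theorem HasSosCertificate.one (d : ℕ) : HasSosCertificate d (fun _ : Fin m → Bool => (1 : ℝ)) := by
  simpa using (HasDegreeLE.const (m := m) (d / 2) 1).hasSosCertificate_sq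

/-- `Σ_d` is convex. [cite: LeeRaghavendraSteurer2015, §2 (p. 11: "the closed, convex cone generated by the squares")] -/
theorem convex_setOf_hasSosCertificate (m d : ℕ) :
    Convex ℝ {f : (Fin m → Bool) → ℝ | HasSosCertificate d f} := by
  intro f hf g hg a b ha hb _
  have h := (HasSosCertificate.const_mul hf ha).add (HasSosCertificate.const_mul hg hb)
  have hfg : a • f + b • g = fun x => a * f x + b * g x := by
    funext x; simp
  simp only [Set.mem_setOf_eq]
  rw [hfg]
  exact h

/-! #### The Gram parametrisation `Ψ(B)(x) = Σ_i ((B q(x))_i)²` and closedness of `Σ_d` -/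

/-- The Gram parametrisation of `Σ_d`: `Ψ(B)(x) = Σ_i (Σ_j B_{ij} q(x)_j)²`, `B ∈ ℝ^{N×N}`,
`N = dim` of the degree-`≤ d/2` space. [cite: LeeRaghavendraSteurer2015, §2 (p. 11)] -/
def sosGram (m d : ℕ) (B : Fin (degDim m (d / 2)) → Fin (degDim m (d / 2)) → ℝ) :
    (Fin m → Bool) → ℝ :=
  fun x => ∑ i, (B i ⬝ᵥ evalCoords m (d / 2) x) ^ 2

/-- `Ψ(B) ∈ Σ_d`. [cite: LeeRaghavendraSteurer2015, §2 (p. 11)] -/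
theorem hasSosCertificate_sosGram (d : ℕ) (B : Fin (degDim m (d / 2)) → Fin (degDim m (d / 2)) → ℝ) :
    HasSosCertificate d (sosGram m d B) :=
  hasSosCertificate_of_fintype (fun i x => B i ⬝ᵥ evalCoords m (d / 2) x)
    (fun i => hasDegreeLE_dotProduct_evalCoords (d / 2) (B i)) fun _ => rfl

/-- **Every element of `Σ_d` is a sum of `N` squares**, `N = dim` of the degree-`≤ d/2` space:
with `λ_i` the coordinates of `g_i`, `f(x) = Σ_i (λ_iᵀ q(x))² = q(x)ᵀ Q q(x)` for
`Q = Σ_i λ_i λ_iᵀ ⪰ 0`, and `Q = S²` (`S = Q^{1/2}` symmetric) gives `f(x) = Σ_i ((S q(x))_i)²`,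
i.e. `f = Ψ(S)`. [cite: LeeRaghavendraSteurer2015, §2 (p. 11)] -/
theorem HasSosCertificate.exists_eq_sosGram {d : ℕ} {f : (Fin m → Bool) → ℝ}
    (hf : HasSosCertificate d f) : ∃ B, f = sosGram m d B := by
  classical
  obtain ⟨k, g, hg, hfx⟩ := hf
  choose lam hlam using fun i => (hg i).exists_eq_dotProduct_evalCoords
  -- the Gram matrix
  let Q : Matrix (Fin (degDim m (d / 2))) (Fin (degDim m (d / 2))) ℝ :=
    ∑ i, vecMulVec (lam i) (lam i)
  have hQ : Q.PosSemidef := posSemidef_sum _ fun i _ => by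
    simpa using posSemidef_vecMulVec_self_star (lam i)
  have hfQ : ∀ x, f x = evalCoords m (d / 2) x ⬝ᵥ (Q *ᵥ evalCoords m (d / 2) x) := by
    intro x
    rw [hfx x]
    simp only [Q, Matrix.sum_mulVec, dotProduct_sum]
    refine sum_congr rfl fun i _ => ?_
    rw [hlam i x]
    simp only [Matrix.mulVec, dotProduct, vecMulVec_apply, sq, Finset.sum_mul, Finset.mul_sum]
    refine sum_congr rfl fun j _ => sum_congr rfl fun l _ => ?_
    ring
  -- its square root
  let S : Matrix (Fin (degDim m (d / 2))) (Fin (degDim m (d / 2))) ℝ := CFC.sqrt Q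
  have hSpsd : S.PosSemidef := (CFC.sqrt_nonneg Q).posSemidef
  have hSS : S * S = Q := CFC.sqrt_mul_sqrt_self Q hQ.nonneg
  have hSt : Sᵀ = S := by
    rw [← conjTranspose_eq_transpose_of_trivial]; exact hSpsd.1
  refine ⟨fun i j => S i j, funext fun x => ?_⟩
  rw [hfQ x, ← hSS, ← mulVec_mulVec, dotProduct_mulVec, ← mulVec_transpose, hSt]
  simp only [sosGram, dotProduct, Matrix.mulVec, sq]

/-- `Σ_d = range Ψ`. [cite: LeeRaghavendraSteurer2015, §2 (p. 11)] -/
theorem setOf_hasSosCertificate_eq_range_sosGram (m d : ℕ) :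
    {f : (Fin m → Bool) → ℝ | HasSosCertificate d f} = Set.range (sosGram m d) := by
  ext f
  constructor
  · intro hf
    obtain ⟨B, rfl⟩ := HasSosCertificate.exists_eq_sosGram hf
    exact ⟨B, rfl⟩
  · rintro ⟨B, rfl⟩
    exact hasSosCertificate_sosGram d B

/-- `Ψ` is continuous. [cite: LeeRaghavendraSteurer2015, §2 (p. 11)] -/
theorem continuous_sosGram (m d : ℕ) : Continuous (sosGram m d) := by
  refine continuous_pi fun x => ?_
  simp only [sosGram, dotProduct]
  fun_prop

/-- The linear map `a ↦ (x ↦ aᵀ q(x))` from coordinates to functions is injective (the `b_l` are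
linearly independent functions). [cite: LeeRaghavendraSteurer2015, §2 (p. 11)] -/
theorem evalCoords_dotProduct_injective (k : ℕ) :
    Function.Injective (fun a : Fin (degDim m k) → ℝ => fun x : Fin m → Bool => a ⬝ᵥ evalCoords m k x) := by
  set bV := Module.finBasis ℝ (degreeLESubmodule m k)
  -- the map is `a ↦ ↑(Σ a_l • b_l)`, injective by linear independence and injectivity of `↑`
  have hrepr : ∀ a : Fin (degDim m k) → ℝ,
      (fun x : Fin m → Bool => a ⬝ᵥ evalCoords m k x) =
        ((∑ l, a l • bV l : degreeLESubmodule m k) : (Fin m → Bool) → ℝ) := by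
    intro a
    funext x
    simp only [Submodule.coe_sum, Submodule.coe_smul, Finset.sum_apply, Pi.smul_apply,
      smul_eq_mul, dotProduct, evalCoords, bV]
  intro a a' h
  have h' : bV.equivFun.symm a = bV.equivFun.symm a' := by
    apply Subtype.ext
    rw [bV.equivFun_symm_apply, bV.equivFun_symm_apply, ← hrepr a, ← hrepr a']
    exact h
  exact bV.equivFun.symm.injective h'

/-- **Norm control on the Gram parametrisation**: there is `K` with `‖B‖ ≤ K √S` whenever
`Σ_x Ψ(B)(x) ≤ S` (anti-Lipschitz bound for the injective map `a ↦ aᵀq(·)`, applied row by row).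
[cite: LeeRaghavendraSteurer2015, §2 (p. 11: "closed")] -/
theorem exists_norm_le_of_sum_sosGram_le (m d : ℕ) :
    ∃ K : ℝ, 0 ≤ K ∧ ∀ (B : Fin (degDim m (d / 2)) → Fin (degDim m (d / 2)) → ℝ) (S : ℝ),
      0 ≤ S → ∑ x, sosGram m d B x ≤ S → ‖B‖ ≤ K * Real.sqrt S := by
  set N := degDim m (d / 2)
  -- the linear map `T a = (x ↦ aᵀ q(x))`
  let T : (Fin N → ℝ) →ₗ[ℝ] ((Fin m → Bool) → ℝ) :=
    { toFun := fun a x => a ⬝ᵥ evalCoords m (d / 2) x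
      map_add' := fun a a' => funext fun x => add_dotProduct a a' _
      map_smul' := fun c a => funext fun x => by simp [smul_dotProduct] }
  have hT : LinearMap.ker T = ⊥ :=
    LinearMap.ker_eq_bot.2 (evalCoords_dotProduct_injective (m := m) (d / 2))
  obtain ⟨K, -, hK⟩ := T.exists_antilipschitzWith hT
  refine ⟨(K : ℝ), K.coe_nonneg, fun B S hS hB => ?_⟩
  have hKS : 0 ≤ (K : ℝ) * Real.sqrt S := mul_nonneg K.2 (Real.sqrt_nonneg S)
  refine (pi_norm_le_iff_of_nonneg hKS).2 fun i => ?_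
  -- `‖B i‖ ≤ K ‖T (B i)‖ ≤ K √S`
  have hTi : ‖T (B i)‖ ≤ Real.sqrt S := by
    refine (pi_norm_le_iff_of_nonneg (Real.sqrt_nonneg S)).2 fun x => ?_
    rw [Real.norm_eq_abs]
    refine Real.abs_le_sqrt ?_
    calc (T (B i) x) ^ 2 = (B i ⬝ᵥ evalCoords m (d / 2) x) ^ 2 := rfl
      _ ≤ ∑ i', (B i' ⬝ᵥ evalCoords m (d / 2) x) ^ 2 :=
          Finset.single_le_sum (f := fun i' => (B i' ⬝ᵥ evalCoords m (d / 2) x) ^ 2)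
            (fun i' _ => sq_nonneg _) (Finset.mem_univ i)
      _ = sosGram m d B x := rfl
      _ ≤ ∑ x', sosGram m d B x' :=
          Finset.single_le_sum (f := fun x' => sosGram m d B x')
            (fun x' _ => sum_nonneg fun i' _ => sq_nonneg _) (Finset.mem_univ x)
      _ ≤ S := hB
  calc ‖B i‖ ≤ K * ‖T (B i)‖ := ZeroHomClass.bound_of_antilipschitz T hK (B i)
    _ ≤ K * Real.sqrt S := mul_le_mul_of_nonneg_left hTi K.2

/-- **The cone `Σ_d` of degree-`d` sums of squares on `{0,1}^m` is closed** ("the closed, convex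
cone generated by the squares of polynomials of degree at most `d/2`").  Proof: `Σ_d = range Ψ`;
near any `f`, the sublevel set `{Σ_x h(x) < S}` meets `range Ψ` inside the compact, hence closed,
set `Ψ(closedBall 0 (K√S))`. [cite: LeeRaghavendraSteurer2015, §2 (p. 11)] -/
theorem isClosed_setOf_hasSosCertificate (m d : ℕ) :
    IsClosed {f : (Fin m → Bool) → ℝ | HasSosCertificate d f} := by
  rw [setOf_hasSosCertificate_eq_range_sosGram, ← closure_subset_iff_isClosed]
  intro f hf
  obtain ⟨K, hK0, hK⟩ := exists_norm_le_of_sum_sosGram_le m d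
  set S : ℝ := |∑ x, f x| + 1 with hS_def
  have hS0 : 0 ≤ S := by positivity
  let U : Set ((Fin m → Bool) → ℝ) := {h | ∑ x, h x < S}
  have hU : IsOpen U := isOpen_lt (continuous_finsetSum _ fun x _ => continuous_apply x)
    continuous_const
  have hfU : f ∈ U := by
    show ∑ x, f x < S
    rw [hS_def]; linarith [le_abs_self (∑ x, f x)]
  have h1 : f ∈ closure (U ∩ Set.range (sosGram m d)) := hU.inter_closure ⟨hfU, hf⟩
  have h2 : U ∩ Set.range (sosGram m d) ⊆
      sosGram m d '' Metric.closedBall 0 (K * Real.sqrt S) := by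
    rintro h ⟨hhU, B, rfl⟩
    refine ⟨B, ?_, rfl⟩
    rw [mem_closedBall_zero_iff]
    exact hK B S hS0 (le_of_lt hhU)
  have h3 : IsClosed (sosGram m d '' Metric.closedBall 0 (K * Real.sqrt S)) :=
    ((isCompact_closedBall _ _).image (continuous_sosGram m d)).isClosed
  obtain ⟨B, -, hB⟩ := closure_minimal h2 h3 h1
  exact ⟨B, hB⟩

/-! ### The duality -/

/-- The linear functional `h ↦ E_x D(x) h(x)` represents every linear functional on functions on the
cube: `ℓ(h) = Σ_x h(x) ℓ(e_x)`. [cite: LeeRaghavendraSteurer2015, §2 (p. 11: "the required pseudo-density D corresponds exactly to (the normal vector of) a hyperplane")] -/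
theorem cubeExpect_repr_functional (ℓ : ((Fin m → Bool) → ℝ) →ₗ[ℝ] ℝ) (h : (Fin m → Bool) → ℝ) :
    cubeExpect (fun x => ((2 : ℝ) ^ m * ℓ (fun y => if x = y then 1 else 0)) * h x) = ℓ h := by
  classical
  rw [ℓ.pi_apply_eq_sum_univ h, cubeExpect]
  have h2 : (2 : ℝ) ^ m ≠ 0 := pow_ne_zero _ two_ne_zero
  rw [div_eq_iff h2, Finset.sum_mul]
  refine sum_congr rfl fun x _ => ?_
  rw [smul_eq_mul]
  ring

/-- `E[g + t] = E[g] + t`. [cite: LeeRaghavendraSteurer2015, §2] -/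
private theorem cubeExpect_add_const' (g : (Fin m → Bool) → ℝ) (t : ℝ) :
    cubeExpect (fun x => g x + t) = cubeExpect g + t := by
  have h1 := cubeExpect_one m
  unfold cubeExpect at h1 ⊢
  rw [Finset.sum_add_distrib, add_div]
  congr 1
  rw [Finset.sum_const, nsmul_eq_mul] at *
  rw [mul_one] at h1
  rw [mul_comm, mul_div_assoc, h1, mul_one]

/-- `E[(g + t) h] = E[g h] + t E[h]`. [cite: LeeRaghavendraSteurer2015, §2] -/
private theorem cubeExpect_add_const_mul' (g h : (Fin m → Bool) → ℝ) (t : ℝ) :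
    cubeExpect (fun x => (g x + t) * h x) = cubeExpect (fun x => g x * h x) + t * cubeExpect h := by
  unfold cubeExpect
  rw [mul_div_assoc', ← add_div, Finset.mul_sum, ← Finset.sum_add_distrib]
  congr 1
  exact sum_congr rfl fun x _ => by ring

/-- `E[(a g) h] = a E[g h]`. [cite: LeeRaghavendraSteurer2015, §2] -/
private theorem cubeExpect_const_mul_mul' (g h : (Fin m → Bool) → ℝ) (a : ℝ) :
    cubeExpect (fun x => a * g x * h x) = a * cubeExpect (fun x => g x * h x) := by
  unfold cubeExpect
  rw [mul_div_assoc', Finset.mul_sum]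
  congr 1
  exact sum_congr rfl fun x _ => by ring

/-- **Lee–Raghavendra–Steurer 2015, §2: sos degree versus pseudo-densities (PROVED).** "The sos
degree of a function is larger than `d` if and only if there exists a degree-`d` pseudo-density `D`
such that `E_x D(x) f(x) < 0`": `f : {0,1}^m → ℝ` has NO degree-`d` sum-of-squares certificate iff
some degree-`d` pseudo-density `D` (`E D = 1`, `E D g² ≥ 0` for `deg g ≤ d/2`) has `E_x D(x) f(x) < 0`.
"⇐" is `IsPseudoDensity.cubeExpect_mul_nonneg`; "⇒": `f ∉ Σ_d`, a closed
(`isClosed_setOf_hasSosCertificate`) convex cone, is strictly separated from it by a linear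
functional `ℓ` (`geometric_hahn_banach_closed_point`), `ℓ ≤ 0` on the cone and `ℓ(f) > 0`;
`D₀(x) = −2^m ℓ(e_x)` has `E D₀ g² ≥ 0`, `E D₀ f < 0`, `E D₀ ≥ 0` (as `1 ∈ Σ_d`), and
`D = (D₀ + t)/E(D₀ + t)` for small `t > 0` is the pseudo-density.
[cite: LeeRaghavendraSteurer2015, §2 (p. 11, the characterization of deg_sos)] -/
theorem not_hasSosCertificate_iff_exists_pseudoDensity {d : ℕ} (f : (Fin m → Bool) → ℝ) :
    ¬ HasSosCertificate d f ↔
      ∃ D : (Fin m → Bool) → ℝ, IsPseudoDensity d D ∧ cubeExpect (fun x => D x * f x) < 0 := by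
  classical
  refine ⟨fun hf => ?_, fun ⟨D, hD, hneg⟩ hf => not_lt.2 (hD.cubeExpect_mul_nonneg hf) hneg⟩
  -- strict separation of `f` from the closed convex cone `Σ_d`
  obtain ⟨ℓ, u, hℓK, hℓf⟩ := geometric_hahn_banach_closed_point
    (convex_setOf_hasSosCertificate m d) (isClosed_setOf_hasSosCertificate m d) hf
  have hu : 0 < u := by
    have := hℓK _ (HasSosCertificate.zero (m := m) d)
    rwa [show (fun _ : Fin m → Bool => (0 : ℝ)) = 0 from rfl, map_zero] at this
  have hℓ_nonpos : ∀ g, HasSosCertificate d g → ℓ g ≤ 0 := by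
    intro g hg
    by_contra hpos
    push Not at hpos
    -- scale `g` until `ℓ` reaches `u`
    have hmem := HasSosCertificate.const_mul hg (div_pos hu hpos).le
    have hlt := hℓK _ hmem
    have hlin : ℓ (fun x => u / ℓ g * g x) = u / ℓ g * ℓ g := by
      have : (fun x => u / ℓ g * g x) = (u / ℓ g) • g := by funext x; simp
      rw [this, map_smul, smul_eq_mul]
    rw [hlin, div_mul_cancel₀ u hpos.ne'] at hlt
    exact lt_irrefl u hlt
  -- the un-normalised density `D₀(x) = −2^m ℓ(e_x)`: `E D₀ h = −ℓ h`
  obtain ⟨D₀, hD₀_def⟩ : ∃ D₀ : (Fin m → Bool) → ℝ,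
      D₀ = fun x => -((2 : ℝ) ^ m * ℓ (fun y => if x = y then 1 else 0)) := ⟨_, rfl⟩
  have hD₀ : ∀ h : (Fin m → Bool) → ℝ, cubeExpect (fun x => D₀ x * h x) = -ℓ h := by
    intro h
    have hrep := cubeExpect_repr_functional (m := m) ℓ.toLinearMap h
    simp only [ContinuousLinearMap.coe_coe] at hrep
    rw [← hrep, hD₀_def]
    simp only [cubeExpect, neg_mul, Finset.sum_neg_distrib, neg_div]
  have hD₀sq : ∀ g, HasDegreeLE (d / 2) g → 0 ≤ cubeExpect (fun x => D₀ x * g x ^ 2) := by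
    intro g hg
    rw [hD₀]
    linarith [hℓ_nonpos _ hg.hasSosCertificate_sq]
  have hD₀f : cubeExpect (fun x => D₀ x * f x) < 0 := by
    rw [hD₀]; linarith
  have hD₀one : 0 ≤ cubeExpect D₀ := by
    have := hD₀sq (fun _ => 1) (HasDegreeLE.const _ 1)
    simpa using this
  -- perturb by the uniform density: `D₁ = D₀ + t`
  set ε : ℝ := -cubeExpect (fun x => D₀ x * f x) with hε
  have hε0 : 0 < ε := by rw [hε]; linarith
  set t : ℝ := ε / (2 * (|cubeExpect f| + 1)) with ht
  have ht0 : 0 < t := by positivity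
  obtain ⟨D₁, hD₁_def⟩ : ∃ D₁ : (Fin m → Bool) → ℝ, D₁ = fun x => D₀ x + t := ⟨_, rfl⟩
  have hD₁exp : ∀ h : (Fin m → Bool) → ℝ,
      cubeExpect (fun x => D₁ x * h x) = cubeExpect (fun x => D₀ x * h x) + t * cubeExpect h := by
    intro h
    rw [hD₁_def]
    exact cubeExpect_add_const_mul' D₀ h t
  have hD₁sq : ∀ g, HasDegreeLE (d / 2) g → 0 ≤ cubeExpect (fun x => D₁ x * g x ^ 2) := by
    intro g hg
    rw [hD₁exp]
    exact add_nonneg (hD₀sq g hg) (mul_nonneg ht0.le (cubeExpect_nonneg fun x => sq_nonneg _))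
  have hD₁f : cubeExpect (fun x => D₁ x * f x) < 0 := by
    rw [hD₁exp]
    have h1 : t * cubeExpect f ≤ t * |cubeExpect f| :=
      mul_le_mul_of_nonneg_left (le_abs_self _) ht0.le
    have h2 : t * |cubeExpect f| < ε := by
      have hpos : 0 < 2 * (|cubeExpect f| + 1) := by positivity
      rw [ht, div_mul_eq_mul_div, div_lt_iff₀ hpos]
      nlinarith [abs_nonneg (cubeExpect f)]
    linarith
  have hD₁pos : 0 < cubeExpect D₁ := by
    rw [hD₁_def, cubeExpect_add_const']
    linarith
  -- normalise
  set μ := cubeExpect D₁ with hμ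
  refine ⟨fun x => μ⁻¹ * D₁ x, ⟨?_, fun g hg => ?_⟩, ?_⟩
  · show cubeExpect (fun x => μ⁻¹ * D₁ x) = 1
    have : cubeExpect (fun x => μ⁻¹ * D₁ x) = μ⁻¹ * cubeExpect D₁ := by
      simp only [cubeExpect, ← Finset.mul_sum, mul_div_assoc]
    rw [this, ← hμ, inv_mul_cancel₀ hD₁pos.ne']
  · rw [cubeExpect_const_mul_mul']
    exact mul_nonneg (inv_nonneg.2 hD₁pos.le) (hD₁sq g hg)
  · rw [cubeExpect_const_mul_mul']
    exact mul_neg_of_pos_of_neg (inv_pos.2 hD₁pos) hD₁f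

/-- The printed characterization in its "`min`" form, one direction each way: `f` has a degree-`d`
sos certificate iff `E_x D(x) f(x) ≥ 0` for every degree-`d` pseudo-density `D`.
[cite: LeeRaghavendraSteurer2015, §2 (p. 11, eq. "deg_sos(f) = min{d ≥ 0 : …}")] -/
theorem hasSosCertificate_iff_forall_pseudoDensity {d : ℕ} (f : (Fin m → Bool) → ℝ) :
    HasSosCertificate d f ↔
      ∀ D : (Fin m → Bool) → ℝ, IsPseudoDensity d D → 0 ≤ cubeExpect (fun x => D x * f x) := by
  refine ⟨fun hf D hD => hD.cubeExpect_mul_nonneg hf, fun h => ?_⟩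
  by_contra hf
  obtain ⟨D, hD, hneg⟩ := (not_hasSosCertificate_iff_exists_pseudoDensity f).1 hf
  exact not_lt.2 (h D hD) hneg

/-! ### The form consumed in §6 (proof of Theorem 6.4) -/

/-- **"No subspace certificate at `c + ε`" gives a pseudo-density with margin `ε`**: if `c + ε − ℑ`
has no degree-`d` sos certificate (`sos_d(ℑ) > c + ε` in the certificate reading of
`SDPRelaxationsMaxCSP.lean`), then some degree-`d` pseudo-density `D` has
`E_x D(x)(c − ℑ(x)) < −ε` (as `E_x D(x)(c + ε − ℑ(x)) < 0` and `E D = 1`).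
[cite: LeeRaghavendraSteurer2015, Thm 6.4 proof (p. 26, first sentence)] -/
theorem exists_pseudoDensity_of_not_subspaceSos {n d : ℕ} {g : (Fin n → Bool) → ℝ} {c ε : ℝ}
    (h : ¬ SubspaceSos (degreeLE n (d / 2)) g (c + ε)) :
    ∃ D : (Fin n → Bool) → ℝ, IsPseudoDensity d D ∧ cubeExpect (fun x => D x * (c - g x)) < -ε := by
  rw [subspaceSos_degreeLE_iff] at h
  obtain ⟨D, hD, hneg⟩ := (not_hasSosCertificate_iff_exists_pseudoDensity _).1 h
  refine ⟨D, hD, ?_⟩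
  have hsplit : cubeExpect (fun x => D x * (c + ε - g x)) =
      cubeExpect (fun x => D x * (c - g x)) + ε * cubeExpect D := by
    unfold cubeExpect
    rw [mul_div_assoc', ← add_div, Finset.mul_sum, ← Finset.sum_add_distrib]
    congr 1
    exact sum_congr rfl fun x _ => by ring
  rw [hsplit, hD.1, mul_one] at hneg
  linarith

/-- **Lee–Raghavendra–Steurer 2015, first step of the proof of Theorem 6.4 (PROVED):** "Given that
the degree-`d(n)` sos relaxation cannot achieve a `(c + ε, s)`-approximation for Max-Π_n, there
exists an instance `ℑ` of Max-Π_n such that `opt(ℑ) ≤ s`, along with a degree-`d(n)` pseudo-density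
`D(x)` such that `E_x D(x)(c − ℑ(x)) < −ε`."  Here "the degree-`d` sos relaxation achieves `(c,s)`"
is `AchievesApprox 𝒫 (degreeLE n (d/2)) c s` (Def. 1.3/1.4 and eq. (2), `SDPRelaxationsMaxCSP.lean`).
[cite: LeeRaghavendraSteurer2015, Thm 6.4 proof (p. 26)] -/
theorem exists_pseudoDensity_of_not_achievesApprox {k n d : ℕ} {P : Set ((Fin k → Bool) → Bool)}
    {c ε s : ℝ} (h : ¬ AchievesApprox P (degreeLE n (d / 2)) (c + ε) s) :
    ∃ I : CSPInstance k n P, I.OptLE s ∧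
      ∃ D : (Fin n → Bool) → ℝ, IsPseudoDensity d D ∧
        cubeExpect (fun x => D x * (c - I.val x)) < -ε := by
  simp only [AchievesApprox, not_forall, exists_prop] at h
  obtain ⟨I, hI, hnot⟩ := h
  exact ⟨I, hI, exists_pseudoDensity_of_not_subspaceSos hnot⟩

end Literature.Combinatorics.Optimization

end
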